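import Summits.Ventures.PercRepro.Night2SevenFiveCore
import Summits.Ventures.PercRepro.Night2TraceAssembly

/-!
# PercRepro — C-025 AT `(7, 5)` ON EVERY FINITE MATROID FROM `f(4) ≤ 10` ON THE CORE ALONE (night-2, gen 4)

`rls_seven_five_of_core_of_ten` (`Night2SevenFiveCore`) needs the rank-`4` flat bound and the trace sums of corner (i);
`sevenFiveTraceSumsCore_of_ten` (`Night2TraceAssembly`) proves the trace sums from the same flat bound.  Hence
**`rls_seven_five_of_ten_only : (∀ Core matroid, every rank-`4` flat has `≤ 10` points) → ∀ M finite, RLS M 7 5`**,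
and in the set-builder spelling of `C025`, `c025_seven_five_of_ten_only`.  The one remaining input, `f(4) ≤ 10` on the
core, is mine-4's paper proof from kernel facts (`data/mine-4/g18/F4-PROOF.md`), typed as `card_le_ten_of_core`.
Imports `Night2SevenFiveCore` and `Night2TraceAssembly`.
-/
namespace PercRepro.Star

open Finset ThmH SixFour GenQ PerFlat ThmN NightThree

/-- **C-025 at `(7, 5)` on every finite matroid from `f(4) ≤ 10` on the core.** -/
theorem rls_seven_five_of_ten_only {γ : Type} [DecidableEq γ]
    (h10 : ∀ {β : Type} [DecidableEq β] (M : Matroid β) [M.Finite] {p : ℕ}, Core M p →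
      ∀ F ∈ flatsQ M 4, F.card ≤ 10)
    (M : Matroid γ) [M.Finite] : RLS M 7 5 :=
  rls_seven_five_of_core_of_ten h10 (sevenFiveTraceSumsCore_of_ten h10) M

/-- **C-025 at `(7, 5)` in the set-builder spelling of `C025`**, from `f(4) ≤ 10` on the core. -/
theorem c025_seven_five_of_ten_only {γ : Type} [DecidableEq γ]
    (h10 : ∀ {β : Type} [DecidableEq β] (M : Matroid β) [M.Finite] {p : ℕ}, Core M p →
      ∀ F ∈ flatsQ M 4, F.card ≤ 10)
    (M : Matroid γ) [M.Finite] :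
    phiK 7 5 * ({A : Set γ | A ⊆ M.E ∧ M.eRk A = ((7 : ℕ) : ℕ∞) ∧ M.eRk (M.E \ A) = ((5 : ℕ) : ℕ∞)}.ncard : ℚ) ≤
      ({A : Set γ | A ⊆ M.E ∧ ((5 : ℕ) : ℕ∞) < M.eRk A ∧ M.eRk A < ((7 : ℕ) : ℕ∞)}.ncard : ℚ) := by
  have h := rls_seven_five_of_ten_only h10 M
  unfold ThmN.RLS at h
  exact h

end PercRepro.Star
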